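import Literature.Computability.Cryptography.PseudoPeriodicCorrMass
import HarnessLib

/-!
# Fourier sampling of a pseudo-periodic table, II: combs with a tolerance

Topic `Computability/Cryptography`; sequel of `PseudoPeriodicCorrMass.lean` (S. of its `IsComb`,
`norm_fibreSum_ge`, `corrMass_ge_of_combs`), brick of the discharge of
`Literature.Computability.Cryptography.Hallgren2007_regulator_qsolvable_delim` (`HallgrenPell.lean`).
Theorem-and-definition file, no named facts.

Jozsa's idealised table `h̃_N` (2003, §10) has comb level sets whose teeth are within `1` of the
arithmetic progression `v₀ + lS` (`[lS] ∈ {⌊lS⌋, ⌈lS⌉}`), which is the tolerance built into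
`PeriodFinding.IsComb`. The table Hallgren's algorithm actually computes carries distances only to
a precision `η`, and its level sets through good starts are combs with teeth within `2w`,
`w = Nη + 1`, of the progression (`HallgrenCombTable.lean`: `BlurredGapTable.abs_tooth_sub_le`,
`filter_range_eq_image`). This file re-runs the analysis of `PseudoPeriodicCorrMass.lean` with a
tolerance parameter `w ≥ 1`:

* `IsCombW Q S w F v₀ p` — the level set through `v₀` on `[0, Q)` is `{r_0, …, r_{p−1}}` with
  `|r_l − (v₀ + lS)| < w`; `IsComb` is the case `w = 1` (`isCombW_one_iff`);
* `norm_fibreSum_ge_of_isCombW` — `‖∑_{v < Q, F v = F v₀} e^{2πi c v/Q}‖ ≥ p/12` whenever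
  `Q ≥ max(100 w, 5S + 5w)`, `30 k w ≤ S` and `|c − kQ/S| ≤ 1/2` (same constants as op. cit., the
  tolerance only shrinks the admissible range of `k`);
* `corrMass_ge_of_combsW` — hence `corrMass Q F c ≥ #G · (p_min/12)²` for a set `G` of good starts.

## References

* R. Jozsa, *Notes on Hallgren's efficient quantum algorithm for solving Pell's equation*,
  arXiv:quant-ph/0302134 (2003), §10 Thm. 6 (proof) and Lemma 3. [Jozsa2003]
-/

noncomputable section

namespace Literature.Computability.Cryptography

namespace PeriodFinding

open Complex Finset Real

variable {Ω : Type*} [DecidableEq Ω]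

/-- **Comb with tolerance `w`**: the level set of `F` through `v₀` on `[0, Q)` is
`{r_0, …, r_{p−1}}` (distinct) with `|r_l − (v₀ + lS)| < w`. [cite: Jozsa2003, §10 (Definition of weak periodicity), Prop. 36] -/
def IsCombW (Q : ℕ) (S w : ℝ) (F : ℕ → Ω) (v₀ p : ℕ) : Prop :=
  ∃ r : ℕ → ℕ, (∀ l < p, |(r l : ℝ) - (v₀ + l * S)| < w) ∧ Set.InjOn r (Set.Iio p) ∧
    (range Q).filter (fun v => F v = F v₀) = (range p).image r

/-- `IsComb` is `IsCombW` with tolerance `1`. [folklore] -/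
theorem isCombW_one_iff (Q : ℕ) (S : ℝ) (F : ℕ → Ω) (v₀ p : ℕ) :
    IsCombW Q S 1 F v₀ p ↔ IsComb Q S F v₀ p := Iff.rfl

/-- Tolerances grow. [folklore] -/
theorem IsCombW.mono {Q : ℕ} {S w w' : ℝ} {F : ℕ → Ω} {v₀ p : ℕ} (h : IsCombW Q S w F v₀ p)
    (hw : w ≤ w') : IsCombW Q S w' F v₀ p := by
  obtain ⟨r, hr, hinj, hset⟩ := h
  exact ⟨r, fun l hl => (hr l hl).trans_le hw, hinj, hset⟩

/-- **A comb with tolerance has a large Fourier coefficient at every character near a small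
multiple of `Q/S`**: with `S ≥ 1`, `w ≥ 1`, `Q ≥ 100 w`, `Q ≥ 5S + 5w`, `30 k w ≤ S` and
`|c − kQ/S| ≤ 1/2`, `‖∑_{v < Q, F v = F v₀} e^{2πi c v/Q}‖ ≥ p/12`.
[cite: Jozsa2003, §10 (proof of Thm. 6: prob(j) ≥ c/S) and Lemma 3] -/
theorem norm_fibreSum_ge_of_isCombW {Q : ℕ} {S w : ℝ} {F : ℕ → Ω} {v₀ p k : ℕ} {c : ℤ}
    (hS : 1 ≤ S) (hw : 1 ≤ w) (hQ : 100 * w ≤ Q) (hQS : 5 * S + 5 * w ≤ Q)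
    (hcomb : IsCombW Q S w F v₀ p) (hk : 30 * (k : ℝ) * w ≤ S) (hc : |(c : ℝ) - k * Q / S| ≤ 1 / 2) :
    (p : ℝ) / 12 ≤ ‖∑ v ∈ (range Q).filter (fun v => F v = F v₀), chr Q c v‖ := by
  obtain ⟨r, hr, hinj, hset⟩ := hcomb
  have hQpos : (0 : ℝ) < Q := by linarith
  have hQ0 : 0 < Q := by exact_mod_cast hQpos
  have hS0 : 0 < S := by linarith
  have hw0 : 0 < w := by linarith
  rw [hset, sum_image (fun x hx y hy h => hinj (mem_coe.mp hx |> mem_range.mp) (mem_coe.mp hy |> mem_range.mp) h)]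
  set ε : ℝ := (c : ℝ) - k * Q / S with hεdef
  have hterm : ∀ l ∈ range p, chr Q c (r l) =
      cexp (2 * π * I * ((c : ℂ) * v₀ / Q)) *
        cexp (2 * π * I * (((ε * S / Q : ℝ) : ℂ) * l +
          ((k * ((r l : ℝ) - (v₀ + l * S)) / S + ε * ((r l : ℝ) - (v₀ + l * S)) / Q : ℝ) : ℂ))) := by
    intro l _
    rw [chr_def]
    have := chr_tooth hQ0 hS0 c k v₀ l (r l) ((r l : ℝ) - (v₀ + l * S)) ε (by ring) (by rw [hεdef]; ring)
    push_cast at this ⊢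
    rw [this]
  have hv₀ : ‖cexp (2 * π * I * ((c : ℂ) * v₀ / Q))‖ = 1 := by
    rw [show (2 * π * I * ((c : ℂ) * v₀ / Q) : ℂ) = 2 * π * I * (((c : ℝ) * v₀ / Q : ℝ) : ℂ) by push_cast; ring]
    exact norm_cexp_two_pi_mul_I _
  rw [sum_congr rfl hterm, ← mul_sum, norm_mul, hv₀, one_mul]
  -- the hypotheses of the perturbation lemma
  have hteeth : ∀ l < p, (l : ℝ) * S < Q + w := by
    intro l hl
    have h1 := hr l hl
    have h2 : r l < Q := by
      have : r l ∈ (range p).image r := mem_image_of_mem r (mem_range.mpr hl)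
      rw [← hset] at this
      exact mem_range.mp (mem_filter.mp this).1
    have h2' : (r l : ℝ) + 1 ≤ Q := by exact_mod_cast h2
    have := (abs_lt.mp h1).1
    have hv : (0 : ℝ) ≤ v₀ := Nat.cast_nonneg _
    linarith
  have hpS : (p : ℝ) * S ≤ Q + w + S := by
    rcases Nat.eq_zero_or_pos p with hp | hp
    · subst hp; simp; linarith
    · have := hteeth (p - 1) (Nat.sub_lt hp one_pos)
      rw [Nat.cast_pred hp] at this
      linarith
  have hεb : |ε| ≤ 1 / 2 := hc
  have hpa : (p : ℝ) * |ε * S / Q| ≤ 3 / 5 := by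
    rw [abs_div, abs_mul, abs_of_pos hS0, abs_of_pos hQpos]
    have hp0 : (0 : ℝ) ≤ p := Nat.cast_nonneg _
    calc (p : ℝ) * (|ε| * S / Q) = (p * S) * |ε| / Q := by ring
      _ ≤ (Q + w + S) * (1 / 2) / Q := by
          apply div_le_div_of_nonneg_right _ hQpos.le
          exact mul_le_mul hpS hεb (abs_nonneg _) (by linarith)
      _ ≤ 3 / 5 := by
          rw [div_le_iff₀ hQpos]; linarith
  have hξb : ∀ l < p, |(k * ((r l : ℝ) - (v₀ + l * S)) / S + ε * ((r l : ℝ) - (v₀ + l * S)) / Q)| ≤ 1 / (8 * π) := by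
    intro l hl
    set el : ℝ := (r l : ℝ) - (v₀ + l * S) with hel
    have he : |el| ≤ w := (hr l hl).le
    have hk0 : (0 : ℝ) ≤ k := Nat.cast_nonneg _
    have h1 : |(k : ℝ) * el / S| ≤ 1 / 30 := by
      rw [abs_div, abs_mul, abs_of_nonneg hk0, abs_of_pos hS0, div_le_iff₀ hS0]
      calc (k : ℝ) * |el| ≤ k * w := mul_le_mul_of_nonneg_left he hk0
        _ ≤ 1 / 30 * S := by linarith
    have h2 : |ε * el / Q| ≤ 1 / 200 := by
      rw [abs_div, abs_mul, abs_of_pos hQpos, div_le_iff₀ hQpos]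
      calc |ε| * |el| ≤ (1 / 2) * w := mul_le_mul hεb he (abs_nonneg _) (by norm_num)
        _ ≤ 1 / 200 * Q := by linarith
    have hπ : 1 / 30 + 1 / 200 ≤ 1 / (8 * π) := by
      rw [le_div_iff₀ (by positivity)]
      have := Real.pi_lt_d2
      nlinarith
    calc |(k : ℝ) * el / S + ε * el / Q| ≤ |(k : ℝ) * el / S| + |ε * el / Q| := abs_add_le _ _
      _ ≤ 1 / (8 * π) := by linarith
  exact norm_sum_exp_perturb_ge (ξ := fun l => k * ((r l : ℝ) - (v₀ + l * S)) / S + ε * ((r l : ℝ) - (v₀ + l * S)) / Q)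
    hpa hξb

/-- **The autocorrelation mass of a blurred pseudo-periodic table at a good character**: if every
start `v₀ ∈ G` (pairwise in different level sets, `G ⊆ [0, Q)`) has a tolerance-`w` comb level set
with at least `p_min` teeth, then `corrMass Q F c ≥ #G · (p_min/12)²` for every `c` within `1/2`
of `kQ/S` with `30 k w ≤ S` (`S, w ≥ 1`, `Q ≥ max(100 w, 5S + 5w)`).
[cite: Jozsa2003, §10 Thm. 6 (proof, eqs. (j1)–(j2) and Lemma 3)] -/
theorem corrMass_ge_of_combsW {Q : ℕ} {S w : ℝ} {F : ℕ → Ω} {k pmin : ℕ} {c : ℤ} (G : Finset ℕ)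
    (hS : 1 ≤ S) (hw : 1 ≤ w) (hQ : 100 * w ≤ Q) (hQS : 5 * S + 5 * w ≤ Q)
    (hk : 30 * (k : ℝ) * w ≤ S) (hc : |(c : ℝ) - k * Q / S| ≤ 1 / 2) (hGQ : ∀ v₀ ∈ G, v₀ < Q)
    (hinj : Set.InjOn F G) (hG : ∀ v₀ ∈ G, ∃ p, pmin ≤ p ∧ IsCombW Q S w F v₀ p) :
    (G.card : ℝ) * ((pmin : ℝ) / 12) ^ 2 ≤ corrMass Q F c := by
  unfold corrMass
  have hsub : G.image F ⊆ (range Q).image F :=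
    image_subset_image (fun v hv => mem_range.mpr (hGQ v hv))
  refine le_trans ?_ (sum_le_sum_of_subset_of_nonneg hsub fun _ _ _ => by positivity)
  rw [sum_image fun x hx y hy h => hinj hx hy h]
  have hb : ∀ v₀ ∈ G, ((pmin : ℝ) / 12) ^ 2 ≤ ‖∑ v ∈ (range Q).filter (fun v => F v = F v₀), chr Q c v‖ ^ 2 := by
    intro v₀ hv₀
    obtain ⟨p, hp, hcomb⟩ := hG v₀ hv₀
    have h1 := norm_fibreSum_ge_of_isCombW hS hw hQ hQS hcomb hk hc
    have h0 : (0 : ℝ) ≤ (pmin : ℝ) / 12 := by positivity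
    have hp' : (pmin : ℝ) / 12 ≤ p / 12 := by
      apply div_le_div_of_nonneg_right _ (by norm_num); exact_mod_cast hp
    exact pow_le_pow_left₀ h0 (hp'.trans h1) 2
  refine le_trans ?_ (sum_le_sum hb)
  rw [sum_const, nsmul_eq_mul]

end PeriodFinding

end Literature.Computability.Cryptography

end
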